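import Summits.CriticalPhenomena.SAWScalingLimit.Theses.SAWLaplacianWalk
import Summits.CriticalPhenomena.SAWScalingLimit.Theorems.SubseqIdentification.Negative.Necessity
import Literature.Probability.RandomPlanarGeometry.DrivingFunctionMeasurable
import Literature.Probability.RandomPlanarGeometry.ConformalRestrictionProofs
import Literature.Probability.RandomPlanarGeometry.CaratheodoryHalfPlaneProofs

/-!
# KS-regularity of subsequential limits (`LimitsDescribable`, stmt-CriticalPhenomena-4481) is NECESSARY for the crux

Negative/structural lemma of the standing disprover of crux `SubseqIdentification`
(stmt-CriticalPhenomena-0783; cdisprove cycle 2), prompted by the lead's PICKED line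
`room-entropy-wright-fisher`, whose composition takes the shared route item
`SAWLaplacianWalk.LimitsDescribable` ("every probability subsequential limit of the critical `δℤ²`
SAW laws is a.s. carried by curves describable by the Loewner evolution through EVERY chordal
uniformizing map, starting at `a`") BY NAME as a hypothesis.

* `ae_isLoewnerDescribable_of_isSLELaw` — a pure SLE fact: for every `κ`, every chordal SLE_κ law
  of `(D; a, b)` is a.s. carried by curve classes describable through EVERY chordal uniformizing map
  `φ'` of `D` (not only the one used to build the curve): two uniformizing maps differ by a dilation
  of `ℍ` (`exists_eq_trans_smul_of_disc`, Carathéodory input discharged in tree), generating curves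
  are dilation covariant (`IsGeneratedByCurve.scale`), the compactified image of the time-rescaled
  trace is a reparametrisation of the curve (`IsCompactifiedImage.comp_mul`), and the describable
  classes form a Borel set (`measurableSet_setOf_isLoewnerDescribable`), so the statement passes to
  the law.
* `ae_isLoewnerDescribable_of_subseqIdentification` — the body of `LimitsDescribable` derived from
  `SubseqIdentification`: the line's only named hypothesis is a COROLLARY of its conclusion
  (assuming it costs the line nothing, exactly as tightness for the conjunct,
  `TightnessNecessity.lean`), and any proof of the crux proves stmt-4481 on the way;
  `not_subseqIdentification_of_not_limitsDescribable` is the contrapositive by name.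
* `limitsDescribable_of_sawScalingLimit`, `not_sawScalingLimit_of_not_limitsDescribable` —
  stmt-4481 is necessary for the LSW conjecture as typed: a refutation of it kills every SAW route.
-/

noncomputable section

open Literature.Probability.RandomPlanarGeometry Literature.Probability.RandomPlanarGeometry.SAW
  Literature.Probability.LatticeModels Literature.Probability MeasureTheory Filter Topology Set
open scoped NNReal ENNReal BoundedContinuousFunction
open UpperHalfPlane (upperHalfPlaneSet)

namespace Summit.CriticalPhenomena.SAWScalingLimit.Theorems.SubseqIdentification.Negative

/-- **Chordal SLE_κ laws are a.s. Loewner-describable through every chordal uniformizing map.**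
[folklore] -/
theorem ae_isLoewnerDescribable_of_isSLELaw {κ : ℝ≥0} {D : DobrushinDomain}
    {ν : Measure (CurveClass ℂ)} (hν : IsSLELaw κ D ν)
    {φ' : ConformalEquiv upperHalfPlaneSet D.carrier} (hφ' : D.IsChordalUniformizing φ') :
    ∀ᵐ c ∂ν, IsLoewnerDescribable φ' c := by
  obtain ⟨Γ, ⟨hΓm, φ, hφ, hae⟩, rfl⟩ := hν
  rw [ae_map_iff hΓm (measurableSet_setOf_isLoewnerDescribable hφ')]
  obtain ⟨r, hr, hEq⟩ := MarkedDomain.IsChordalUniformizing.exists_eq_trans_smul_of_disc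
    JordanDomain.exists_continuousOn_extension_holds hφ hφ'
  -- the dilation factor as an element of `ℝ≥0`
  obtain ⟨rn, hrn0, hrn⟩ : ∃ rn : ℝ≥0, rn ≠ 0 ∧ (rn : ℝ) = r :=
    ⟨r.toNNReal, (Real.toNNReal_pos.2 hr).ne', Real.coe_toNNReal r hr.le⟩
  have hρ0 : rn⁻¹ ≠ 0 := inv_ne_zero hrn0
  have hr2 : rn ^ 2 ≠ 0 := pow_ne_zero 2 hrn0
  filter_upwards [hae] with ω ⟨hgen, c, hΓω, hc⟩
  -- the time-rescaled, dilated trace `s ↦ r⁻¹ γ(r² s)` is generated by `s ↦ r⁻¹ W(r² s)`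
  have hgen' := hgen.scale hρ0
  have hcomp := hc.comp_mul hr2
  have hdiv : ∀ s : ℝ≥0, s / rn⁻¹ ^ 2 = rn ^ 2 * s := fun s => by
    rw [div_eq_mul_inv, inv_pow, inv_inv, mul_comm]
  refine ⟨_, ⟨continuous_const.mul ((continuous_sleDriving κ ω).comp (continuous_id.div_const _)),
    _, hgen', c.reparam _, by rw [hΓω, CurveClass.mk_reparam], fun s hs => ?_, hcomp.2⟩⟩
  -- compactified images: `φ'(r⁻¹ γ(r² ρ)) = φ(γ(r² ρ))`
  rw [hcomp.1 s hs, φ.boundaryExtension_eq_of_eqOn_smul_trans φ' hr hEq]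
  beta_reduce
  rw [hdiv, Complex.real_smul, ← mul_assoc, ← hrn, ← Complex.ofReal_mul, NNReal.coe_inv,
    mul_inv_cancel₀ (NNReal.coe_ne_zero.2 hrn0), Complex.ofReal_one, one_mul]

/-- With the a.s. starting point: an SLE_κ law is a.s. carried by describable classes from `a`.
[folklore] -/
theorem ae_isLoewnerDescribable_and_source_of_isSLELaw {κ : ℝ≥0} {D : DobrushinDomain}
    {ν : Measure (CurveClass ℂ)} (hν : IsSLELaw κ D ν)
    {φ' : ConformalEquiv upperHalfPlaneSet D.carrier} (hφ' : D.IsChordalUniformizing φ') :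
    ∀ᵐ c ∂ν, IsLoewnerDescribable φ' c ∧ c.source = D.pt 0 := by
  filter_upwards [ae_isLoewnerDescribable_of_isSLELaw hν hφ',
    IsSLELaw.ae_endpoints JordanDomain.mapsTo_boundaryExtension_holds hν] with c h1 h2
  exact ⟨h1, h2.1⟩

open Summit.CriticalPhenomena.SAWScalingLimit.Theses.SAWRenewalTightness (SubseqIdentification)
open Summit.CriticalPhenomena.SAWScalingLimit.Theses.SAWLaplacianWalk (LimitsDescribable)

/-- **Under the crux, subsequential limits are KS-regular** — literally the body of
`SAWLaplacianWalk.LimitsDescribable` (item stmt-CriticalPhenomena-4481, the named hypothesis of the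
picked line `room-entropy-wright-fisher` and of every martingale line), derived from
`SubseqIdentification`: under the crux every probability subsequential limit is the SLE_{8/3} law,
which is a.s. describable through every chordal uniformizing map and starts at `a`. So the line
loses nothing by assuming stmt-4481: it is a COROLLARY of the line's own conclusion. (Stated with
the body spelled out rather than by the name `LimitsDescribable`, so that this support lemma is not
read as a proof of item 4481; `example` below records that the two agree definitionally.) [folklore] -/
theorem ae_isLoewnerDescribable_of_subseqIdentification (h : SubseqIdentification)
    (D : DobrushinDomain) (a b : ℝ → Site 2) (hab : IsEndpointApprox D a b)
    (φ : ConformalEquiv upperHalfPlaneSet D.carrier) (hφ : D.IsChordalUniformizing φ)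
    (ν : Measure (CurveClass ℂ)) (hν : IsProbabilityMeasure ν)
    (hsub : IsSubseqLimitLaw (fun δ (γ : DomainSAW D.carrier δ (a δ) (b δ)) => γ.curve)
      (fun δ => law D.carrier δ (a δ) (b δ)) ν) :
    ∀ᵐ c ∂ν, IsLoewnerDescribable φ c ∧ c.source = D.pt 0 := by
  obtain ⟨s, hs, hlim⟩ := hsub
  exact ae_isLoewnerDescribable_and_source_of_isSLELaw (h D a b hab s ν hs hν hlim) hφ

example (h : SubseqIdentification) : LimitsDescribable :=
  ae_isLoewnerDescribable_of_subseqIdentification h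

/-- **`SAWScalingLimit → LimitsDescribable`**: stmt-4481 is NECESSARY for the conjunct (via
`subseqIdentification_of_sawScalingLimit`). [folklore] -/
theorem limitsDescribable_of_sawScalingLimit (h : SAW.SAWScalingLimit) : LimitsDescribable :=
  ae_isLoewnerDescribable_of_subseqIdentification (subseqIdentification_of_sawScalingLimit h)

/-- Contrapositive, for the negatives index: a refutation of stmt-4481 refutes the LSW conjecture
as typed (every SAW route). [folklore] -/
theorem not_sawScalingLimit_of_not_limitsDescribable (h : ¬ LimitsDescribable) :
    ¬ SAW.SAWScalingLimit :=
  fun h' => h (limitsDescribable_of_sawScalingLimit h')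

/-- … and refutes the crux. [folklore] -/
theorem not_subseqIdentification_of_not_limitsDescribable (h : ¬ LimitsDescribable) :
    ¬ SubseqIdentification :=
  fun h' => h (ae_isLoewnerDescribable_of_subseqIdentification h')

end Summit.CriticalPhenomena.SAWScalingLimit.Theorems.SubseqIdentification.Negative
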